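import Summits.Ventures.PercRepro.C041RcPortValid

/-!
# THEOREM R, the rc reduction: the sources of the family `𝒮_rc(O)` as the admissible valid patterns times the
outside colourings (p6, gen 24)

Setting of `C041RcPortValid`.  `IsRcSrc O S`: a `(D,A)` source with bare colouring `O` all of whose attached zones
are rc (`RcAttach`).  `RcOutside O S` reads only the edges that are NOT terminal edges at port vertices: the bare part,
the edges between the terminals (red), the terminal edges at the vertices outside `K` (a vertex outside `K` with a
blue terminal edge is switchable; no two blue-bare-connected vertices outside `K` carry blue edges to both
terminals).  **`rcSrc_iff`**: `IsRcSrc O S ↔ Adm (rcPattern S) ∧ (X₁ ∨ X₂) (rcPattern S) ∧ RcOutside O S` — the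
converse dictionary.  `rcRecolour x′ S` replaces the colours of the terminal edges at the port vertices by `x′`
and keeps everything else: its pattern is `x′` (`rcPattern_rcRecolour`), it keeps `RcOutside` (`outside_rcRecolour`),
recolouring by the own pattern is the identity, and recolourings compose — the fibre bijection of the count.
-/

namespace PercRepro

namespace MultiGraph

open Finset ZonePort

variable {V E : Type*} {G : MultiGraph V E}

section Src

variable [Fintype V] {a b c : V} (hca : c ≠ a) (hcb : c ≠ b)
  (hc : ∀ e, ¬ G.Joins e c a ∧ ¬ G.Joins e c b) (hne : a ≠ b) (O : Config E)

/-- A source of the rc family with bare colouring `O`. -/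
def IsRcSrc (G : MultiGraph V E) (a b c : V) (O S : Config E) : Prop :=
  G.AgreeBare a b O S ∧ G.RcAttach a b O S ∧
    ((G.Conn S c a ∧ G.Conn S c b) ∧ (¬ G.Conn Sᶜ c a ∧ ¬ G.Conn Sᶜ c b ∧ ¬ G.Conn Sᶜ a b))

/-- The outside conditions: what a source requires of the edges that are not terminal edges at port vertices. -/
def RcOutside (G : MultiGraph V E) (a b c : V) (O S : Config E) : Prop :=
  G.AgreeBare a b O S ∧ (∀ e, G.Joins e a b → S e = true) ∧
    (∀ u, u ∉ G.BareReach a b c O → (G.BlueTo a S u ∨ G.BlueTo b S u) → G.Switchable a b c O u) ∧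
    (∀ u u', u ∉ G.BareReach a b c O → u' ∉ G.BareReach a b c O → G.BlueBareConn a b O u u' →
      ¬ (G.BlueTo a S u ∧ G.BlueTo b S u'))

variable {O}

omit [Fintype V] in
/-- The probe is outside the blue cluster of `a` in a source. -/
theorem rc_c_not_mem_cluster_a {S : Config E} (h : ¬ G.Conn Sᶜ c a) : c ∉ G.cluster Sᶜ a :=
  fun hc' => h ((G.mem_cluster).1 hc').symm

omit [Fintype V] in
/-- The probe is outside the blue cluster of `b` in a source. -/
theorem rc_c_not_mem_cluster_b {S : Config E} (h : ¬ G.Conn Sᶜ c b) : c ∉ G.cluster Sᶜ b :=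
  fun hc' => h ((G.mem_cluster).1 hc').symm

include hca hcb hc hne in
/-- **A source has an admissible valid pattern.** -/
theorem adm_valid_of_rcSrc (habE : ∃ e, G.Joins e a b) {S : Config E} (hS : G.IsRcSrc a b c O S) :
    (G.rcPort a b c O hca hcb hc).Adm (rcPattern hca hcb hc S) ∧
      ((G.rcPort a b c O hca hcb hc).X₁ (rcPattern hca hcb hc S) ∨
        (G.rcPort a b c O hca hcb hc).X₂ (rcPattern hca hcb hc S)) := by
  obtain ⟨hagree, hrc, hred, hca', hcb', hab'⟩ := hS
  obtain ⟨e, he⟩ := habE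
  refine ⟨rc_adm hca hcb hc hne hagree hrc (noDoubleZone_of_not_conn hagree hab') (rc_c_not_mem_cluster_a hca')
    (rc_c_not_mem_cluster_b hcb'), ?_⟩
  exact (rc_red_iff_X hca hcb hc hne hagree ⟨e, he, rc_terminal_red_of_not_conn hab' e he⟩).1 hred

include hca hcb hc hne in
open Classical in
/-- **The weight of the pattern of a source is its Good-degree weight.** -/
theorem weight_of_rcSrc {S : Config E} (hS : G.IsRcSrc a b c O S) :
    (G.rcPort a b c O hca hcb hc).weight (rcPattern hca hcb hc S) =
      (if G.WalkAvoiding S (G.cluster Sᶜ a) c b then 3 else 0) +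
        (if G.WalkAvoiding S (G.cluster Sᶜ b) c a then 3 else 0) - 2 := by
  obtain ⟨hagree, hrc, _, hca', hcb', hab'⟩ := hS
  exact rc_weight hca hcb hc hne hagree (rc_terminal_red_of_not_conn hab') (noDoubleZone_of_not_conn hagree hab') hrc
    (rc_c_not_mem_cluster_a hca') (rc_c_not_mem_cluster_b hcb')

/-- **A source satisfies the outside conditions.** -/
theorem outside_of_rcSrc {S : Config E} (hS : G.IsRcSrc a b c O S) : G.RcOutside a b c O S := by
  obtain ⟨hagree, hrc, _, hca', hcb', hab'⟩ := hS
  refine ⟨hagree, rc_terminal_red_of_not_conn hab', fun u _ hu => ?_, fun u u' _ _ huu' h => ?_⟩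
  · exact switchable_of_blue hagree hrc (rc_c_not_mem_cluster_a hca') (rc_c_not_mem_cluster_b hcb') hu
  · exact noDoubleZone_of_not_conn hagree hab' u u' huu' h

include hca hcb hc in
/-- A port vertex with a blue terminal edge in an admissible pattern is switchable. -/
theorem switchable_of_adm_blue {S : Config E} (hadm : (G.rcPort a b c O hca hcb hc).Adm (rcPattern hca hcb hc S))
    {u : V} (huK : u ∈ G.BareReach a b c O) (hu : G.BlueTo a S u ∨ G.BlueTo b S u) :
    G.Switchable a b c O u := by
  have hpv : G.IsPortVert a b c O u := by
    refine ⟨huK, ?_⟩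
    rcases hu with ⟨e, hj, _⟩ | ⟨e, hj, _⟩
    · exact ⟨e, Or.inl hj⟩
    · exact ⟨e, Or.inr hj⟩
  obtain ⟨e, hje, hSe⟩ : ∃ e, (G.Joins e u a ∨ G.Joins e u b) ∧ S e = false := by
    rcases hu with ⟨e, hj, hS⟩ | ⟨e, hj, hS⟩
    · exact ⟨e, Or.inl hj, hS⟩
    · exact ⟨e, Or.inr hj, hS⟩
  let te : G.TE a b c O := ⟨e, u, hpv, hje⟩
  have htv : G.tvOf a b e = u := tvOf_eq_of_portVert a b c O hca hcb hpv hje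
  -- the zone of `u` is switchable by admissibility (its edge `e` is blue)
  have hsw : (G.rcPort a b c O hca hcb hc).sw ((G.rcPort a b c O hca hcb hc).tz te) = true := by
    by_contra h
    have h' : (G.rcPort a b c O hca hcb hc).sw ((G.rcPort a b c O hca hcb hc).tz te) = false := by
      cases hh : (G.rcPort a b c O hca hcb hc).sw ((G.rcPort a b c O hca hcb hc).tz te)
      · rfl
      · exact absurd hh h
    have := hadm.1 (toTerm hca hcb hc te) h'
    rw [rcPattern_apply] at this
    show False
    rw [show (toTerm hca hcb hc te).1.1 = e from rfl] at this
    rw [this] at hSe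
    exact Bool.noConfusion hSe
  rw [sw_true_iff, rcPort_tz, htv] at hsw
  obtain ⟨v, hv, hsv⟩ := hsw
  exact switchable_of_mem a b c O ((mem_zone a b O).2 ((mem_zone a b O).1
    (portZone_subset_zone a b c O u hv)).symm) hsv

include hca hcb hc hne in
/-- **No doubly attached zone**, from admissibility and the outside conditions. -/
theorem noDoubleZone_of_adm {S : Config E} (hadm : (G.rcPort a b c O hca hcb hc).Adm (rcPattern hca hcb hc S))
    (hout : G.RcOutside a b c O S) : G.NoDoubleZone a b O S := by
  rintro u u' huu' ⟨hu, hu'⟩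
  by_cases huK : u ∈ G.BareReach a b c O <;> by_cases huK' : u' ∈ G.BareReach a b c O
  · -- both port vertices: the same switchable zone carries a blue 1-edge and a blue 2-edge
    obtain ⟨e, hje, hSe⟩ := hu
    obtain ⟨f, hjf, hSf⟩ := hu'
    have hsu := switchable_of_adm_blue hca hcb hc hadm huK (Or.inl ⟨e, hje, hSe⟩)
    have hsu' := switchable_of_adm_blue hca hcb hc hadm huK' (Or.inr ⟨f, hjf, hSf⟩)
    let te : G.TE a b c O := ⟨e, u, ⟨huK, e, Or.inl hje⟩, Or.inl hje⟩
    let tf : G.TE a b c O := ⟨f, u', ⟨huK', f, Or.inr hjf⟩, Or.inr hjf⟩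
    have htv : G.tvOf a b e = u := tvOf_eq_of_portVert a b c O hca hcb ⟨huK, e, Or.inl hje⟩ (Or.inl hje)
    have htv' : G.tvOf a b f = u' := tvOf_eq_of_portVert a b c O hca hcb ⟨huK', f, Or.inr hjf⟩ (Or.inr hjf)
    have hzone : (G.rcPort a b c O hca hcb hc).tz te = (G.rcPort a b c O hca hcb hc).tz tf := by
      rw [rcPort_tz, rcPort_tz, htv, htv', portZone_of_switchable a b c O hsu,
        portZone_of_switchable a b c O hsu']
      exact zone_eq_of_blueBareConn a b O huu'
    have hts : (G.rcPort a b c O hca hcb hc).ts te = false := by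
      rw [ts_false_iff hca hcb hc hne]
      show G.Joins e (G.tvOf a b e) a
      rw [htv]
      exact hje
    have hts' : (G.rcPort a b c O hca hcb hc).ts tf = true := by
      rw [ts_true_iff hca hcb hc hne]
      show G.Joins f (G.tvOf a b f) b
      rw [htv']
      exact hjf
    rcases hadm.2 (toTerm hca hcb hc te) (toTerm hca hcb hc tf) hzone hts hts' with h | h
    · rw [rcPattern_apply] at h
      rw [show (toTerm hca hcb hc te).1.1 = e from rfl] at h
      rw [h] at hSe
      exact Bool.noConfusion hSe
    · rw [rcPattern_apply] at h
      rw [show (toTerm hca hcb hc tf).1.1 = f from rfl] at h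
      rw [h] at hSf
      exact Bool.noConfusion hSf
  · -- `u` a port vertex, `u'` outside `K`: the rc zone of `u` would leave `K`
    have hsu := switchable_of_adm_blue hca hcb hc hadm huK (Or.inl hu)
    exact huK' (mem_bareReach_of_rc a b c O hsu.1 (self_mem_zone a b O u) huK ((mem_zone a b O).2 huu'))
  · have hsu' := switchable_of_adm_blue hca hcb hc hadm huK' (Or.inr hu')
    exact huK (mem_bareReach_of_rc a b c O hsu'.1 (self_mem_zone a b O u') huK' ((mem_zone a b O).2 huu'.symm))
  · exact hout.2.2.2 u u' huK huK' huu' ⟨hu, hu'⟩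

include hca hcb hc hne in
/-- **THE CONVERSE DICTIONARY**: a configuration with an admissible valid pattern satisfying the outside
conditions is a source of the rc family. -/
theorem rcSrc_of_adm (habE : ∃ e, G.Joins e a b) {S : Config E}
    (hadm : (G.rcPort a b c O hca hcb hc).Adm (rcPattern hca hcb hc S))
    (hval : (G.rcPort a b c O hca hcb hc).X₁ (rcPattern hca hcb hc S) ∨
      (G.rcPort a b c O hca hcb hc).X₂ (rcPattern hca hcb hc S))
    (hout : G.RcOutside a b c O S) : G.IsRcSrc a b c O S := by
  have hnd := noDoubleZone_of_adm hca hcb hc hne hadm hout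
  obtain ⟨hagree, hab, hsw, _⟩ := hout
  -- a vertex with a blue terminal edge is switchable
  have hswitch : ∀ u, (G.BlueTo a S u ∨ G.BlueTo b S u) → G.Switchable a b c O u := by
    intro u hu
    by_cases huK : u ∈ G.BareReach a b c O
    · exact switchable_of_adm_blue hca hcb hc hadm huK hu
    · exact hsw u huK hu
  obtain ⟨e₀, he₀⟩ := habE
  refine ⟨hagree, fun u hu => (hswitch u hu).1, ?_, ?_, ?_, ?_⟩
  · exact (rc_red_iff_X hca hcb hc hne hagree ⟨e₀, he₀, hab e₀ he₀⟩).2 hval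
  · intro h
    rcases rc_cluster_compl_a_subset hagree hab hnd ((G.mem_cluster).2 h.symm) with h' | ⟨u, hu, huc⟩
    · exact hca h'
    · exact (hswitch u (Or.inl hu)).2 huc.symm
  · intro h
    rcases rc_cluster_compl_b_subset hagree hab hnd ((G.mem_cluster).2 h.symm) with h' | ⟨u, hu, huc⟩
    · exact hcb h'
    · exact (hswitch u (Or.inr hu)).2 huc.symm
  · intro h
    exact rc_b_not_mem_cluster_compl_a hagree hab hnd hne ((G.mem_cluster).2 h)

include hca hcb hc hne in
/-- **The sources of the rc family are the admissible valid patterns times the outside colourings.** -/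
theorem rcSrc_iff (habE : ∃ e, G.Joins e a b) {S : Config E} :
    G.IsRcSrc a b c O S ↔
      ((G.rcPort a b c O hca hcb hc).Adm (rcPattern hca hcb hc S) ∧
        ((G.rcPort a b c O hca hcb hc).X₁ (rcPattern hca hcb hc S) ∨
          (G.rcPort a b c O hca hcb hc).X₂ (rcPattern hca hcb hc S))) ∧ G.RcOutside a b c O S :=
  ⟨fun hS => ⟨adm_valid_of_rcSrc hca hcb hc hne habE hS, outside_of_rcSrc hS⟩,
    fun ⟨⟨hadm, hval⟩, hout⟩ => rcSrc_of_adm hca hcb hc hne habE hadm hval hout⟩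

end Src

end MultiGraph

end PercRepro
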